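import Mathlib.Analysis.Calculus.Deriv.Inv
import Literature.Analysis.FunctionSpaces.ContDiffHolderLeibnizSharp
import HarnessLib

/-!
# Hölder envelopes: geometric bookkeeping of the `C^{j,0}` and `C^{j,r}` norms

Analysis/FunctionSpaces support file (everything proved). Buckmaster–De Lellis–Székelyhidi–Vicol
2019 estimate amplitudes and phases of the perturbation step through bounds of the form
"`‖f‖_N ≲ A ℓ^{-N}` for all `N`" and interpolation ((A.1)–(A.4)); in the stationary phase lemma
(App. C, Prop. C.2, after Daneri–Székelyhidi 2017, Lemma 2.2) the amplitude `a` and the phase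
gradient enter tame estimates whose proof, once (A.1) has put every intermediate norm of ONE
function at a geometric rate (`‖f‖_{j,r'} ≤ C ρ^{j+r'}‖f‖₀`, `ρ^{N+α} = ‖f‖_{N+α}/‖f‖₀`), is pure
bookkeeping of rates. This file packages that bookkeeping for the accepted norms
`eContDiffHolderNorm j r` (`∑_{i≤j}‖Dⁱf‖_∞ + [Dʲf]_r`, `HolderNorm.lean`) INCLUDING the Hölder top,
which the sup-norm envelopes of `OnsagerBDSVEnvelope.lean` (`BDSV.HasEnvelope`) do not carry:

* `HolderEnvelope f n r A H ρ`: `f` is `C^∞`, `1 ≤ ρ`, and for all `j ≤ n`,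
  `‖f‖_{C^{j,0}} ≤ A ρʲ` and `‖f‖_{C^{j,r}} ≤ H ρʲ` (so `H` plays the role of `A ρ^r`; only NATURAL
  powers of the rate occur, all quantities in `ℝ≥0∞`);
* its calculus, all PROVED: constants, sums, continuous linear images, continuous BILINEAR images
  (`HolderEnvelope.bilinear`: amplitudes `(c A_f A_g, c (H_f A_g + A_f H_g))` — from the SHARP
  Leibniz estimate `eContDiffHolderNorm_bilinear_le_sharp`, the point being that the sup amplitude
  of a product involves no Hölder amplitude), one derivative (`(A, H) ↦ (Aρ, Hρ)`, order `n-1`),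
  and the RECIPROCAL of a real function bounded below (`HolderEnvelope.inv`: `1/s` has amplitudes
  `(C, C H_s)` with `C = C(n, c, K)` when `s ≥ c > 0` has amplitudes `(K, H_s)`; induction on the
  order through `D(1/s) = -s⁻² Ds`).

Spaces are taken in one universe (the Leibniz estimate is proved by an induction that changes the
value spaces).

## References

* T. Buckmaster, C. De Lellis, L. Székelyhidi Jr., V. Vicol, *Onsager's conjecture for admissible
  weak solutions*, CPAM 72 (2019) = arXiv:1701.08678, App. A (A.1)–(A.4); App. C Prop. C.2.
  [`BuckmasterEtAl2018`]
* S. Daneri, L. Székelyhidi Jr., *Non-uniqueness and h-principle for Hölder-continuous weak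
  solutions of the Euler equations*, ARMA 224 (2017) = arXiv:1603.09714, Lemma 2.2 (proof: the
  bounds `[a_N ∇φ/|∇φ|²]_s ≤ C([a_j]_{N-j+s} + ‖a_j‖₀[∇φ]_{N-j+s})`). [`DaneriSzekelyhidi2017`]
-/

open Set Filter
open scoped NNReal ENNReal ContDiff

noncomputable section

universe u

set_option maxSynthPendingDepth 3

namespace Literature.Analysis.FunctionSpaces

section General

variable {E Y Z : Type*} [NormedAddCommGroup E] [NormedSpace ℝ E]
  [NormedAddCommGroup Y] [NormedSpace ℝ Y] [NormedAddCommGroup Z] [NormedSpace ℝ Z]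

/-- **Hölder envelope** of a smooth map: `‖f‖_{C^{j,0}} ≤ A ρʲ` and `‖f‖_{C^{j,r}} ≤ H ρʲ` for all
`j ≤ n`, with a rate `ρ ≥ 1` (the geometric bookkeeping into which (A.1) puts the intermediate
Hölder norms of one function; `H` plays the role of `A ρ^r`). [folklore] -/
structure HolderEnvelope (f : E → Y) (n : ℕ) (r : ℝ≥0) (A H ρ : ℝ≥0∞) : Prop where
  /-- the map is smooth -/
  contDiff : ContDiff ℝ ∞ f
  /-- the rate is at least one -/
  one_le : 1 ≤ ρ
  /-- the `C^{j,0}` norms grow at most geometrically -/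
  norm_zero_le : ∀ j ≤ n, eContDiffHolderNorm j 0 f ≤ A * ρ ^ j
  /-- the `C^{j,r}` norms grow at most geometrically -/
  norm_le : ∀ j ≤ n, eContDiffHolderNorm j r f ≤ H * ρ ^ j

namespace HolderEnvelope

variable {f g : E → Y} {n n' : ℕ} {r : ℝ≥0} {A A' H H' ρ : ℝ≥0∞}

/-- `C^k` regularity at every finite order. [folklore] -/
theorem contDiff_nat (h : HolderEnvelope f n r A H ρ) (k : ℕ) : ContDiff ℝ k f :=
  h.contDiff.of_le (by exact_mod_cast le_top)

/-- Powers of the rate are monotone: `ρⁱ ≤ ρʲ` for `i ≤ j`. [folklore] -/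
theorem pow_le_pow (h : HolderEnvelope f n r A H ρ) {i j : ℕ} (hij : i ≤ j) : ρ ^ i ≤ ρ ^ j :=
  pow_le_pow_right₀ h.one_le hij

/-- `1 ≤ ρʲ`. [folklore] -/
theorem one_le_pow (h : HolderEnvelope f n r A H ρ) (j : ℕ) : 1 ≤ ρ ^ j :=
  one_le_pow₀ h.one_le

/-- Monotonicity in the order and the amplitudes. [folklore] -/
theorem mono (h : HolderEnvelope f n r A H ρ) (hn : n' ≤ n) (hA : A ≤ A') (hH : H ≤ H') :
    HolderEnvelope f n' r A' H' ρ where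
  contDiff := h.contDiff
  one_le := h.one_le
  norm_zero_le j hj := (h.norm_zero_le j (hj.trans hn)).trans (mul_le_mul' hA le_rfl)
  norm_le j hj := (h.norm_le j (hj.trans hn)).trans (mul_le_mul' hH le_rfl)

/-- The sup norm is within the sup amplitude: `‖f‖_∞ ≤ A`. [folklore] -/
theorem eSupNorm_le (h : HolderEnvelope f n r A H ρ) : eSupNorm f ≤ A := by
  have := h.norm_zero_le 0 (Nat.zero_le n)
  rw [pow_zero, mul_one] at this
  exact (eSupNorm_le_eContDiffHolderNorm 0 0 f).trans this

/-- The `C^{0,r}` norm is within the Hölder amplitude: `‖f‖_{0,r} ≤ H`. [folklore] -/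
theorem norm_zero_r_le (h : HolderEnvelope f n r A H ρ) : eContDiffHolderNorm 0 r f ≤ H := by
  have := h.norm_le 0 (Nat.zero_le n)
  rwa [pow_zero, mul_one] at this

/-! ### Constants, sums, linear images -/

omit [NormedSpace ℝ E] in
/-- The `C^{k,r'}` norm of a constant map is `‖c‖` (all derivatives vanish, the Hölder seminorm of
a constant is zero). [folklore] -/
theorem _root_.Literature.Analysis.FunctionSpaces.eContDiffHolderNorm_const_le [NormedSpace ℝ E]
    (k : ℕ) (r' : ℝ≥0) (c : Y) : eContDiffHolderNorm k r' (fun _ : E => c) ≤ ‖c‖ₑ := by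
  unfold eContDiffHolderNorm
  have hD : ∀ j, 1 ≤ j → iteratedFDeriv ℝ j (fun _ : E => c) = 0 := fun j hj => by
    funext x
    rw [iteratedFDeriv_const_of_ne (Nat.one_le_iff_ne_zero.1 hj)]
  have hsum : ∑ j ∈ Finset.range (k + 1), eSupNorm (iteratedFDeriv ℝ j (fun _ : E => c)) ≤ ‖c‖ₑ := by
    rw [Finset.sum_range_succ']
    have h0 : ∑ j ∈ Finset.range k, eSupNorm (iteratedFDeriv ℝ (j + 1) (fun _ : E => c)) = 0 :=
      Finset.sum_eq_zero fun j _ => by rw [hD (j + 1) (Nat.succ_pos j)]; exact eSupNorm_zero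
    rw [h0, zero_add, eSupNorm_iteratedFDeriv_zero]
    exact iSup_le fun _ => le_rfl
  have hH : eHolderNorm r' (iteratedFDeriv ℝ k (fun _ : E => c)) = 0 := by
    rcases Nat.eq_zero_or_pos k with rfl | hk
    · rw [eHolderNorm_iteratedFDeriv_zero]
      exact eHolderNorm_const E r' c
    · rw [hD k hk]
      exact eHolderNorm_zero E r'
  rw [hH, add_zero]
  exact hsum

/-- A constant map has the envelope `(‖c‖, ‖c‖, ρ)` at every order and rate `ρ ≥ 1`. [folklore] -/
theorem const (c : Y) (n : ℕ) (r : ℝ≥0) (hρ : 1 ≤ ρ) :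
    HolderEnvelope (fun _ : E => c) n r ‖c‖ₑ ‖c‖ₑ ρ where
  contDiff := contDiff_const
  one_le := hρ
  norm_zero_le j _ := (eContDiffHolderNorm_const_le j 0 c).trans
    (le_mul_of_one_le_right' (one_le_pow₀ hρ))
  norm_le j _ := (eContDiffHolderNorm_const_le j r c).trans
    (le_mul_of_one_le_right' (one_le_pow₀ hρ))

/-- Sum of two envelopes with the same rate: amplitudes add. [folklore] -/
theorem add {Ag Hg : ℝ≥0∞} (hf : HolderEnvelope f n r A H ρ) (hg : HolderEnvelope g n r Ag Hg ρ) :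
    HolderEnvelope (fun x => f x + g x) n r (A + Ag) (H + Hg) ρ where
  contDiff := hf.contDiff.add hg.contDiff
  one_le := hf.one_le
  norm_zero_le j hj := by
    calc eContDiffHolderNorm j 0 (fun x => f x + g x)
        ≤ eContDiffHolderNorm j 0 f + eContDiffHolderNorm j 0 g :=
          eContDiffHolderNorm_add_le (hf.contDiff_nat j) (hg.contDiff_nat j)
      _ ≤ A * ρ ^ j + Ag * ρ ^ j := add_le_add (hf.norm_zero_le j hj) (hg.norm_zero_le j hj)
      _ = (A + Ag) * ρ ^ j := by ring
  norm_le j hj := by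
    calc eContDiffHolderNorm j r (fun x => f x + g x)
        ≤ eContDiffHolderNorm j r f + eContDiffHolderNorm j r g :=
          eContDiffHolderNorm_add_le (hf.contDiff_nat j) (hg.contDiff_nat j)
      _ ≤ H * ρ ^ j + Hg * ρ ^ j := add_le_add (hf.norm_le j hj) (hg.norm_le j hj)
      _ = (H + Hg) * ρ ^ j := by ring

/-- Negation preserves envelopes. [folklore] -/
theorem neg (hf : HolderEnvelope f n r A H ρ) : HolderEnvelope (fun x => -f x) n r A H ρ where
  contDiff := hf.contDiff.neg
  one_le := hf.one_le
  norm_zero_le j hj := by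
    rw [show (fun x => -f x) = -f from rfl, eContDiffHolderNorm_neg]; exact hf.norm_zero_le j hj
  norm_le j hj := by
    rw [show (fun x => -f x) = -f from rfl, eContDiffHolderNorm_neg]; exact hf.norm_le j hj

/-- Continuous linear images: amplitudes scale by `‖L‖`. [folklore] -/
theorem clm_comp (L : Y →L[ℝ] Z) (hf : HolderEnvelope f n r A H ρ) :
    HolderEnvelope (fun x => L (f x)) n r (‖L‖ₑ * A) (‖L‖ₑ * H) ρ where
  contDiff := L.contDiff.comp hf.contDiff
  one_le := hf.one_le
  norm_zero_le j hj := (eContDiffHolderNorm_clm_comp_le L (hf.contDiff_nat j) 0).trans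
    (by rw [mul_assoc]; exact mul_le_mul' le_rfl (hf.norm_zero_le j hj))
  norm_le j hj := (eContDiffHolderNorm_clm_comp_le L (hf.contDiff_nat j) r).trans
    (by rw [mul_assoc]; exact mul_le_mul' le_rfl (hf.norm_le j hj))

/-- A larger rate is still a rate. [folklore] -/
theorem rate_mono {ρ' : ℝ≥0∞} (h : HolderEnvelope f n r A H ρ) (hρ : ρ ≤ ρ') :
    HolderEnvelope f n r A H ρ' where
  contDiff := h.contDiff
  one_le := h.one_le.trans hρ
  norm_zero_le j hj := (h.norm_zero_le j hj).trans (mul_le_mul' le_rfl (pow_le_pow_left' hρ j))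
  norm_le j hj := (h.norm_le j hj).trans (mul_le_mul' le_rfl (pow_le_pow_left' hρ j))

/-- Real scalar multiples: amplitudes scale by `|c|`. [folklore] -/
theorem const_smul (c : ℝ) (hf : HolderEnvelope f n r A H ρ) :
    HolderEnvelope (fun x => c • f x) n r (‖c‖ₑ * A) (‖c‖ₑ * H) ρ where
  contDiff := hf.contDiff.const_smul c
  one_le := hf.one_le
  norm_zero_le j hj := by
    rw [show (fun x => c • f x) = c • f from rfl, eContDiffHolderNorm_const_smul (hf.contDiff_nat j),
      mul_assoc]
    exact mul_le_mul' le_rfl (hf.norm_zero_le j hj)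
  norm_le j hj := by
    rw [show (fun x => c • f x) = c • f from rfl, eContDiffHolderNorm_const_smul (hf.contDiff_nat j),
      mul_assoc]
    exact mul_le_mul' le_rfl (hf.norm_le j hj)

/-- Real multiples of real functions: amplitudes scale by `|c|`. [folklore] -/
theorem const_mul (c : ℝ) {f : E → ℝ} (hf : HolderEnvelope f n r A H ρ) :
    HolderEnvelope (fun x => c * f x) n r (‖c‖ₑ * A) (‖c‖ₑ * H) ρ :=
  hf.const_smul c

/-- Finite sums of envelopes with a common rate: amplitudes add. [folklore] -/
theorem sum {ι : Type*} (s : Finset ι) {F : ι → E → Y} {AF HF : ι → ℝ≥0∞} (hρ : 1 ≤ ρ)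
    (h : ∀ i ∈ s, HolderEnvelope (F i) n r (AF i) (HF i) ρ) :
    HolderEnvelope (fun x => ∑ i ∈ s, F i x) n r (∑ i ∈ s, AF i) (∑ i ∈ s, HF i) ρ := by
  classical
  induction s using Finset.induction_on with
  | empty =>
    simp only [Finset.sum_empty]
    exact (HolderEnvelope.const (0 : Y) n r hρ).mono le_rfl (by simp) (by simp)
  | insert a s ha ih =>
    simp only [Finset.sum_insert ha]
    exact (h a (Finset.mem_insert_self a s)).add (ih fun i hi => h i (Finset.mem_insert_of_mem hi))

end HolderEnvelope

end General

/-! ### Bilinear images -/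

section Bilinear

variable {E Y₁ Y₂ Z : Type u} [NormedAddCommGroup E] [NormedSpace ℝ E]
  [NormedAddCommGroup Y₁] [NormedSpace ℝ Y₁] [NormedAddCommGroup Y₂] [NormedSpace ℝ Y₂]
  [NormedAddCommGroup Z] [NormedSpace ℝ Z]
variable {n : ℕ} {r : ℝ≥0} {ρ : ℝ≥0∞}

/-- **Bilinear images of envelopes** (from the sharp Leibniz estimate): if `f`, `g` have envelopes
`(A_f, H_f, ρ)`, `(A_g, H_g, ρ)` to order `n`, then `B(f,g)` has the envelope
`(2·3ⁿ(n+1)‖B‖ A_f A_g, 3ⁿ(n+1)‖B‖ (H_f A_g + A_f H_g), ρ)` to order `n` — the sup amplitude of the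
product involves no Hölder amplitude. [folklore] -/
theorem HolderEnvelope.bilinear (B : Y₁ →L[ℝ] Y₂ →L[ℝ] Z) {f : E → Y₁} {g : E → Y₂} {Af Hf Ag Hg : ℝ≥0∞}
    (hf : HolderEnvelope f n r Af Hf ρ) (hg : HolderEnvelope g n r Ag Hg ρ) :
    HolderEnvelope (fun x => B (f x) (g x)) n r
      (2 * (3 ^ n * (n + 1)) * ‖B‖ₑ * (Af * Ag))
      (3 ^ n * (n + 1) * ‖B‖ₑ * (Hf * Ag + Af * Hg)) ρ where
  contDiff := B.isBoundedBilinearMap.contDiff.comp₂ hf.contDiff hg.contDiff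
  one_le := hf.one_le
  norm_zero_le k hk := by
    have hL := eContDiffHolderNorm_bilinear_le_sharp B (hf.contDiff_nat k) (hg.contDiff_nat k) 0
    refine hL.trans ?_
    -- each summand is `≤ 2 Af Ag ρ^k`
    have hterm : ∀ j ∈ Finset.range (k + 1),
        eContDiffHolderNorm j 0 f * eContDiffHolderNorm (k - j) 0 g +
          eContDiffHolderNorm j 0 f * eContDiffHolderNorm (k - j) 0 g ≤ 2 * (Af * Ag) * ρ ^ k := by
      intro j hj
      have hjk : j ≤ k := by simpa [Finset.mem_range, Nat.lt_succ_iff] using hj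
      have h1 : eContDiffHolderNorm j 0 f * eContDiffHolderNorm (k - j) 0 g ≤ Af * Ag * ρ ^ k := by
        calc eContDiffHolderNorm j 0 f * eContDiffHolderNorm (k - j) 0 g
            ≤ (Af * ρ ^ j) * (Ag * ρ ^ (k - j)) :=
              mul_le_mul' (hf.norm_zero_le j (hjk.trans hk))
                (hg.norm_zero_le (k - j) ((Nat.sub_le k j).trans hk))
          _ = Af * Ag * ρ ^ k := by
              rw [show Af * ρ ^ j * (Ag * ρ ^ (k - j)) = Af * Ag * (ρ ^ j * ρ ^ (k - j)) by ring,
                ← pow_add, Nat.add_sub_cancel' hjk]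
      calc _ ≤ Af * Ag * ρ ^ k + Af * Ag * ρ ^ k := add_le_add h1 h1
        _ = 2 * (Af * Ag) * ρ ^ k := by ring
    calc 3 ^ k * ‖B‖ₑ * ∑ j ∈ Finset.range (k + 1),
          (eContDiffHolderNorm j 0 f * eContDiffHolderNorm (k - j) 0 g +
            eContDiffHolderNorm j 0 f * eContDiffHolderNorm (k - j) 0 g)
        ≤ 3 ^ k * ‖B‖ₑ * ∑ _j ∈ Finset.range (k + 1), 2 * (Af * Ag) * ρ ^ k :=
          mul_le_mul' le_rfl (Finset.sum_le_sum hterm)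
      _ = 3 ^ k * (k + 1) * ‖B‖ₑ * (2 * (Af * Ag)) * ρ ^ k := by
          rw [Finset.sum_const, Finset.card_range, nsmul_eq_mul]; push_cast; ring
      _ ≤ 3 ^ n * (n + 1) * ‖B‖ₑ * (2 * (Af * Ag)) * ρ ^ k := by
          have h3 : (3 : ℝ≥0∞) ^ k * (k + 1) ≤ 3 ^ n * (n + 1) :=
            mul_le_mul' (pow_le_pow_right₀ (by norm_num) hk) (by exact_mod_cast Nat.succ_le_succ hk)
          exact mul_le_mul' (mul_le_mul' (mul_le_mul' h3 le_rfl) le_rfl) le_rfl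
      _ = 2 * (3 ^ n * (n + 1)) * ‖B‖ₑ * (Af * Ag) * ρ ^ k := by ring
  norm_le k hk := by
    have hL := eContDiffHolderNorm_bilinear_le_sharp B (hf.contDiff_nat k) (hg.contDiff_nat k) r
    refine hL.trans ?_
    have hterm : ∀ j ∈ Finset.range (k + 1),
        eContDiffHolderNorm j r f * eContDiffHolderNorm (k - j) 0 g +
          eContDiffHolderNorm j 0 f * eContDiffHolderNorm (k - j) r g ≤ (Hf * Ag + Af * Hg) * ρ ^ k := by
      intro j hj
      have hjk : j ≤ k := by simpa [Finset.mem_range, Nat.lt_succ_iff] using hj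
      have hpow : ρ ^ j * ρ ^ (k - j) = ρ ^ k := by rw [← pow_add, Nat.add_sub_cancel' hjk]
      have h1 : eContDiffHolderNorm j r f * eContDiffHolderNorm (k - j) 0 g ≤ Hf * Ag * ρ ^ k := by
        calc eContDiffHolderNorm j r f * eContDiffHolderNorm (k - j) 0 g
            ≤ (Hf * ρ ^ j) * (Ag * ρ ^ (k - j)) :=
              mul_le_mul' (hf.norm_le j (hjk.trans hk))
                (hg.norm_zero_le (k - j) ((Nat.sub_le k j).trans hk))
          _ = Hf * Ag * ρ ^ k := by
              rw [show Hf * ρ ^ j * (Ag * ρ ^ (k - j)) = Hf * Ag * (ρ ^ j * ρ ^ (k - j)) by ring, hpow]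
      have h2 : eContDiffHolderNorm j 0 f * eContDiffHolderNorm (k - j) r g ≤ Af * Hg * ρ ^ k := by
        calc eContDiffHolderNorm j 0 f * eContDiffHolderNorm (k - j) r g
            ≤ (Af * ρ ^ j) * (Hg * ρ ^ (k - j)) :=
              mul_le_mul' (hf.norm_zero_le j (hjk.trans hk))
                (hg.norm_le (k - j) ((Nat.sub_le k j).trans hk))
          _ = Af * Hg * ρ ^ k := by
              rw [show Af * ρ ^ j * (Hg * ρ ^ (k - j)) = Af * Hg * (ρ ^ j * ρ ^ (k - j)) by ring, hpow]
      calc _ ≤ Hf * Ag * ρ ^ k + Af * Hg * ρ ^ k := add_le_add h1 h2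
        _ = (Hf * Ag + Af * Hg) * ρ ^ k := by ring
    calc 3 ^ k * ‖B‖ₑ * ∑ j ∈ Finset.range (k + 1),
          (eContDiffHolderNorm j r f * eContDiffHolderNorm (k - j) 0 g +
            eContDiffHolderNorm j 0 f * eContDiffHolderNorm (k - j) r g)
        ≤ 3 ^ k * ‖B‖ₑ * ∑ _j ∈ Finset.range (k + 1), (Hf * Ag + Af * Hg) * ρ ^ k :=
          mul_le_mul' le_rfl (Finset.sum_le_sum hterm)
      _ = 3 ^ k * (k + 1) * ‖B‖ₑ * (Hf * Ag + Af * Hg) * ρ ^ k := by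
          rw [Finset.sum_const, Finset.card_range, nsmul_eq_mul]; push_cast; ring
      _ ≤ 3 ^ n * (n + 1) * ‖B‖ₑ * (Hf * Ag + Af * Hg) * ρ ^ k := by
          have h3 : (3 : ℝ≥0∞) ^ k * (k + 1) ≤ 3 ^ n * (n + 1) :=
            mul_le_mul' (pow_le_pow_right₀ (by norm_num) hk) (by exact_mod_cast Nat.succ_le_succ hk)
          exact mul_le_mul' (mul_le_mul' (mul_le_mul' h3 le_rfl) le_rfl) le_rfl

end Bilinear

section General₂

variable {E Y : Type*} [NormedAddCommGroup E] [NormedSpace ℝ E] [NormedAddCommGroup Y]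
  [NormedSpace ℝ Y]

namespace HolderEnvelope

variable {f : E → Y} {n : ℕ} {r : ℝ≥0} {A H ρ : ℝ≥0∞}

/-! ### One derivative -/

/-- **One derivative** shifts the order and multiplies both amplitudes by the rate:
`‖Df‖_{j,·} ≤ ‖f‖_{j+1,·}`. [folklore] -/
theorem fderiv (hf : HolderEnvelope f (n + 1) r A H ρ) :
    HolderEnvelope (_root_.fderiv ℝ f) n r (A * ρ) (H * ρ) ρ where
  contDiff := hf.contDiff.fderiv_right (by exact_mod_cast le_top)
  one_le := hf.one_le
  norm_zero_le j hj := (eContDiffHolderNorm_fderiv_le j 0 f).trans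
    ((hf.norm_zero_le (j + 1) (Nat.succ_le_succ hj)).trans (by rw [pow_succ]; exact le_of_eq (by ring)))
  norm_le j hj := (eContDiffHolderNorm_fderiv_le j r f).trans
    ((hf.norm_le (j + 1) (Nat.succ_le_succ hj)).trans (by rw [pow_succ]; exact le_of_eq (by ring)))

end HolderEnvelope

end General₂

/-! ### The reciprocal of a real function bounded below -/

section Inv

variable {E : Type} [NormedAddCommGroup E] [NormedSpace ℝ E]

/-- The derivative of `1/s`: `D(s⁻¹)(x) = -(s x)⁻² Ds(x)` for `s x ≠ 0`. [folklore] -/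
theorem fderiv_fun_inv_eq_smul {s : E → ℝ} {x : E} (hs : DifferentiableAt ℝ s x) (hx : s x ≠ 0) :
    fderiv ℝ (fun y => (s y)⁻¹) x = (-((s x) ^ 2)⁻¹) • fderiv ℝ s x := by
  have h := (hasFDerivAt_inv hx).comp x hs.hasFDerivAt
  rw [show (fun y => (s y)⁻¹) = (fun t : ℝ => t⁻¹) ∘ s from rfl, h.fderiv]
  ext v
  simp [ContinuousLinearMap.toSpanSingleton_apply, mul_comm]

/-- `1/s` is smooth for smooth `s` without zeros. [folklore] -/
theorem contDiff_fun_inv {s : E → ℝ} (hs : ContDiff ℝ ∞ s) (h0 : ∀ x, s x ≠ 0) :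
    ContDiff ℝ ∞ fun y => (s y)⁻¹ :=
  contDiff_iff_contDiffAt.2 fun x => (hs.contDiffAt).inv (h0 x)

/-- The `C^{0,0}` and `C^{0,r}` norms of `1/s` for `s ≥ c > 0`:
`‖s⁻¹‖_{0,0} ≤ 3/c` and `‖s⁻¹‖_{0,r} ≤ 1/c + [s]_r/c²`. [folklore] -/
theorem eContDiffHolderNorm_zero_fun_inv_le {s : E → ℝ} {c : ℝ} (hc : 0 < c) (hcs : ∀ x, c ≤ s x)
    (r : ℝ≥0) :
    eContDiffHolderNorm 0 0 (fun y => (s y)⁻¹) ≤ ENNReal.ofReal (3 / c) ∧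
      eContDiffHolderNorm 0 r (fun y => (s y)⁻¹) ≤
        ENNReal.ofReal c⁻¹ + ENNReal.ofReal (c ^ 2)⁻¹ * eContDiffHolderNorm 0 r s := by
  have hpos : ∀ x, 0 < s x := fun x => hc.trans_le (hcs x)
  have hsup : eSupNorm (fun y => (s y)⁻¹) ≤ ENNReal.ofReal c⁻¹ := by
    refine eSupNorm_le_ofReal fun x => ?_
    rw [Real.norm_eq_abs, abs_of_pos (inv_pos.2 (hpos x))]
    exact inv_anti₀ hc (hcs x)
  -- increments: `|1/s x - 1/s y| = |s y - s x|/(s x s y) ≤ |s x - s y|/c²`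
  have hincr : ∀ x y, edist ((s x)⁻¹) ((s y)⁻¹) ≤ ENNReal.ofReal (c ^ 2)⁻¹ * edist (s x) (s y) := by
    intro x y
    rw [edist_dist, edist_dist, ← ENNReal.ofReal_mul (by positivity), Real.dist_eq, Real.dist_eq]
    refine ENNReal.ofReal_le_ofReal ?_
    have hx := hpos x; have hy := hpos y
    rw [inv_sub_inv hx.ne' hy.ne', abs_div, abs_of_pos (mul_pos hx hy), abs_sub_comm,
      div_eq_mul_inv, mul_comm]
    refine mul_le_mul_of_nonneg_right ?_ (abs_nonneg _)
    rw [inv_le_inv₀ (mul_pos hx hy) (by positivity), sq]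
    exact mul_le_mul (hcs x) (hcs y) hc.le hx.le
  constructor
  · -- oscillation `≤ 2/c`
    rw [eContDiffHolderNorm_zero_eq]
    have hosc : eHolderNorm 0 (fun y => (s y)⁻¹) ≤ ENNReal.ofReal (2 / c) := by
      refine eHolderNorm_le_of_forall_edist_le fun x y => ?_
      rw [NNReal.coe_zero, ENNReal.rpow_zero, mul_one, edist_dist, Real.dist_eq]
      refine ENNReal.ofReal_le_ofReal ?_
      have h1 : |(s x)⁻¹| ≤ c⁻¹ := by
        rw [abs_of_pos (inv_pos.2 (hpos x))]; exact inv_anti₀ hc (hcs x)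
      have h2 : |(s y)⁻¹| ≤ c⁻¹ := by
        rw [abs_of_pos (inv_pos.2 (hpos y))]; exact inv_anti₀ hc (hcs y)
      calc |(s x)⁻¹ - (s y)⁻¹| ≤ |(s x)⁻¹| + |(s y)⁻¹| := abs_sub _ _
        _ ≤ c⁻¹ + c⁻¹ := add_le_add h1 h2
        _ = 2 / c := by ring
    calc eSupNorm (fun y => (s y)⁻¹) + eHolderNorm 0 (fun y => (s y)⁻¹)
        ≤ ENNReal.ofReal c⁻¹ + ENNReal.ofReal (2 / c) := add_le_add hsup hosc
      _ = ENNReal.ofReal (3 / c) := by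
          rw [← ENNReal.ofReal_add (by positivity) (by positivity)]; congr 1; ring
  · rw [eContDiffHolderNorm_zero_eq, eContDiffHolderNorm_zero_eq]
    have hH : eHolderNorm r (fun y => (s y)⁻¹) ≤ ENNReal.ofReal (c ^ 2)⁻¹ * eHolderNorm r s := by
      by_cases hmem : MemHolder r s
      · have hHW := hmem.holderWith
        refine (HolderWith.eHolderNorm_le (C := Real.toNNReal (c ^ 2)⁻¹ * nnHolderNorm r s)
          fun x y => ?_).trans (le_of_eq ?_)
        · calc edist ((s x)⁻¹) ((s y)⁻¹) ≤ ENNReal.ofReal (c ^ 2)⁻¹ * edist (s x) (s y) := hincr x y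
            _ ≤ ENNReal.ofReal (c ^ 2)⁻¹ * ((nnHolderNorm r s : ℝ≥0∞) * edist x y ^ (r : ℝ)) :=
                mul_le_mul_of_nonneg_left (hHW x y) bot_le
            _ = _ := by rw [ENNReal.coe_mul, ENNReal.ofReal]; ring
        · rw [ENNReal.coe_mul, hmem.coe_nnHolderNorm_eq_eHolderNorm, ENNReal.ofReal]
      · have htop : eHolderNorm r s = ⊤ := by rwa [← eHolderNorm_ne_top, not_ne_iff] at hmem
        rw [htop, ENNReal.mul_top (by positivity)]
        exact le_top
    calc eSupNorm (fun y => (s y)⁻¹) + eHolderNorm r (fun y => (s y)⁻¹)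
        ≤ ENNReal.ofReal c⁻¹ + ENNReal.ofReal (c ^ 2)⁻¹ * eHolderNorm r s := add_le_add hsup hH
      _ ≤ ENNReal.ofReal c⁻¹ + ENNReal.ofReal (c ^ 2)⁻¹ * (eSupNorm s + eHolderNorm r s) := by
          gcongr; exact le_add_self

/-- `‖mul‖ ≤ 1` for the multiplication of real numbers, in `ℝ≥0∞`. [folklore] -/
theorem enorm_mul_le_one : ‖(ContinuousLinearMap.mul ℝ ℝ : ℝ →L[ℝ] ℝ →L[ℝ] ℝ)‖ₑ ≤ 1 := by
  rw [enorm_eq_nnnorm, ← ENNReal.coe_one, ENNReal.coe_le_coe, ← NNReal.coe_le_coe, coe_nnnorm,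
    NNReal.coe_one]
  exact ContinuousLinearMap.opNorm_mul_le ℝ ℝ

/-- `‖lsmul‖ ≤ 1` for the scalar multiplication `ℝ × Z → Z`, in `ℝ≥0∞`. [folklore] -/
theorem enorm_lsmul_le_one {Z : Type*} [NormedAddCommGroup Z] [NormedSpace ℝ Z] :
    ‖(ContinuousLinearMap.lsmul ℝ ℝ : ℝ →L[ℝ] Z →L[ℝ] Z)‖ₑ ≤ 1 := by
  rw [enorm_eq_nnnorm, ← ENNReal.coe_one, ENNReal.coe_le_coe, ← NNReal.coe_le_coe, coe_nnnorm,
    NNReal.coe_one]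
  exact ContinuousLinearMap.opNorm_lsmul_le

/-- Absorbing a constant into a geometric bound: `a + b ρᵏ ≤ (a + b) ρᵏ` for `ρ ≥ 1`. [folklore] -/
theorem add_mul_pow_le {a b ρ : ℝ≥0∞} (hρ : 1 ≤ ρ) (k : ℕ) : a + b * ρ ^ k ≤ (a + b) * ρ ^ k := by
  rw [add_mul]
  exact add_le_add (le_mul_of_one_le_right' (one_le_pow₀ hρ)) le_rfl

variable [Nonempty E]

/-- The constant of the reciprocal rule at the next order. [folklore] -/
def invConst (c : ℝ) (n : ℕ) (K Cn : ℝ≥0) : ℝ≥0 :=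
  Real.toNNReal (3 / c) + Real.toNNReal (2 * (c ^ 2)⁻¹) + 4 * 9 ^ n * ((n : ℝ≥0) + 1) ^ 2 * Cn ^ 2 * (K + 1)

/-- **The reciprocal rule, inductive step**: if `s ≥ c > 0` has the envelope `(K, H, ρ)` to order
`n+1` and `1/s` is already known to have the envelope `(Cₙ, Cₙ H, ρ)` to order `n`, then `1/s` has
the envelope `(C, C H, ρ)` to order `n+1` with `C = invConst c n K Cₙ` — through
`‖s⁻¹‖_{j+1,·} = ‖s⁻¹‖_∞ + ‖D(s⁻¹)‖_{j,·}`, `D(s⁻¹) = -(s⁻¹)² • Ds` and the bilinear rule. [folklore] -/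
theorem HolderEnvelope.inv_step {s : E → ℝ} {c : ℝ} (hc : 0 < c) (hcs : ∀ x, c ≤ s x) {n : ℕ}
    {r : ℝ≥0} {K Cn : ℝ≥0} {H ρ : ℝ≥0∞} (hs : HolderEnvelope s (n + 1) r K H ρ)
    (hw : HolderEnvelope (fun y => (s y)⁻¹) n r Cn (Cn * H) ρ) :
    HolderEnvelope (fun y => (s y)⁻¹) (n + 1) r (invConst c n K Cn) (invConst c n K Cn * H) ρ := by
  have hpos : ∀ x, 0 < s x := fun x => hc.trans_le (hcs x)
  have hne : ∀ x, s x ≠ 0 := fun x => (hpos x).ne'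
  have hρ := hs.one_le
  set w : E → ℝ := fun y => (s y)⁻¹ with hw_def
  -- `c ≤ H`: the Hölder amplitude dominates `‖s‖_∞ ≥ c`
  have hcH : ENNReal.ofReal c ≤ H := by
    obtain ⟨x⟩ := ‹Nonempty E›
    calc ENNReal.ofReal c ≤ ‖s x‖ₑ := by
          rw [← ofReal_norm, Real.norm_eq_abs, abs_of_pos (hpos x)]
          exact ENNReal.ofReal_le_ofReal (hcs x)
      _ ≤ eSupNorm s := enorm_le_eSupNorm s x
      _ ≤ eContDiffHolderNorm 0 r s := eSupNorm_le_eContDiffHolderNorm 0 r s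
      _ ≤ H := hs.norm_zero_r_le
  have hcinv : ENNReal.ofReal c⁻¹ ≤ ENNReal.ofReal (c ^ 2)⁻¹ * H := by
    calc ENNReal.ofReal c⁻¹ = ENNReal.ofReal (c ^ 2)⁻¹ * ENNReal.ofReal c := by
          rw [← ENNReal.ofReal_mul (by positivity)]; congr 1; field_simp
      _ ≤ ENNReal.ofReal (c ^ 2)⁻¹ * H := mul_le_mul_of_nonneg_left hcH bot_le
  -- order zero
  obtain ⟨h00, h0r⟩ := eContDiffHolderNorm_zero_fun_inv_le hc hcs r (s := s)
  have hsup : eSupNorm w ≤ ENNReal.ofReal c⁻¹ := by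
    refine eSupNorm_le_ofReal fun x => ?_
    rw [hw_def, Real.norm_eq_abs, abs_of_pos (inv_pos.2 (hpos x))]
    exact inv_anti₀ hc (hcs x)
  -- the derivative `Dw = q • Ds`, `q = -(w w)`
  set q : E → ℝ := fun x => -(w x * w x) with hq_def
  have hDw : _root_.fderiv ℝ w = fun x => q x • _root_.fderiv ℝ s x := by
    funext x
    rw [hw_def, fderiv_fun_inv_eq_smul ((hs.contDiff.differentiable (by simp)) x) (hne x), hq_def,
      sq, mul_inv]
  -- envelopes of `w w`, `q`, `Ds`, `q • Ds`
  set c₀ : ℝ≥0∞ := 3 ^ n * (n + 1) with hc₀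
  have hww : HolderEnvelope (fun x => w x * w x) n r (2 * c₀ * ((Cn : ℝ≥0∞) * Cn))
      (c₀ * ((Cn : ℝ≥0∞) * H * Cn + Cn * (Cn * H))) ρ := by
    have h := hw.bilinear (ContinuousLinearMap.mul ℝ ℝ) hw
    simp only [ContinuousLinearMap.mul_apply'] at h
    refine h.mono le_rfl ?_ ?_
    · calc 2 * (3 ^ n * (n + 1)) * ‖(ContinuousLinearMap.mul ℝ ℝ : ℝ →L[ℝ] ℝ →L[ℝ] ℝ)‖ₑ *
            ((Cn : ℝ≥0∞) * Cn) ≤ 2 * (3 ^ n * (n + 1)) * 1 * ((Cn : ℝ≥0∞) * Cn) := by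
            gcongr; exact enorm_mul_le_one
        _ = _ := by rw [mul_one, hc₀]
    · calc 3 ^ n * (n + 1) * ‖(ContinuousLinearMap.mul ℝ ℝ : ℝ →L[ℝ] ℝ →L[ℝ] ℝ)‖ₑ *
            ((Cn : ℝ≥0∞) * H * Cn + Cn * (Cn * H))
          ≤ 3 ^ n * (n + 1) * 1 * ((Cn : ℝ≥0∞) * H * Cn + Cn * (Cn * H)) := by
            gcongr; exact enorm_mul_le_one
        _ = _ := by rw [mul_one, hc₀]
  have hq : HolderEnvelope q n r (2 * c₀ * ((Cn : ℝ≥0∞) * Cn)) (2 * c₀ * ((Cn : ℝ≥0∞) * Cn) * H) ρ := by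
    have h := hww.neg
    refine h.mono le_rfl le_rfl (le_of_eq ?_)
    ring
  have hDs := hs.fderiv
  have hprod : HolderEnvelope (fun x => q x • _root_.fderiv ℝ s x) n r
      (4 * c₀ ^ 2 * ((Cn : ℝ≥0∞) * Cn) * K * ρ)
      (2 * c₀ ^ 2 * ((Cn : ℝ≥0∞) * Cn) * (K + 1) * H * ρ) ρ := by
    have h := hq.bilinear (ContinuousLinearMap.lsmul ℝ ℝ : ℝ →L[ℝ] (E →L[ℝ] ℝ) →L[ℝ] (E →L[ℝ] ℝ)) hDs
    simp only [ContinuousLinearMap.lsmul_apply] at h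
    refine h.mono le_rfl ?_ ?_
    · calc 2 * (3 ^ n * (n + 1)) *
            ‖(ContinuousLinearMap.lsmul ℝ ℝ : ℝ →L[ℝ] (E →L[ℝ] ℝ) →L[ℝ] (E →L[ℝ] ℝ))‖ₑ *
            (2 * c₀ * ((Cn : ℝ≥0∞) * Cn) * ((K : ℝ≥0∞) * ρ))
          ≤ 2 * (3 ^ n * (n + 1)) * 1 * (2 * c₀ * ((Cn : ℝ≥0∞) * Cn) * ((K : ℝ≥0∞) * ρ)) := by
            gcongr; exact enorm_lsmul_le_one
        _ = _ := by rw [mul_one, hc₀]; ring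
    · calc 3 ^ n * (n + 1) *
            ‖(ContinuousLinearMap.lsmul ℝ ℝ : ℝ →L[ℝ] (E →L[ℝ] ℝ) →L[ℝ] (E →L[ℝ] ℝ))‖ₑ *
            (2 * c₀ * ((Cn : ℝ≥0∞) * Cn) * H * ((K : ℝ≥0∞) * ρ) +
              2 * c₀ * ((Cn : ℝ≥0∞) * Cn) * (H * ρ))
          ≤ 3 ^ n * (n + 1) * 1 *
            (2 * c₀ * ((Cn : ℝ≥0∞) * Cn) * H * ((K : ℝ≥0∞) * ρ) +
              2 * c₀ * ((Cn : ℝ≥0∞) * Cn) * (H * ρ)) := by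
            gcongr; exact enorm_lsmul_le_one
        _ = _ := by rw [mul_one, hc₀]; ring
  -- the constant
  set C : ℝ≥0 := invConst c n K Cn with hC
  have hCA : ENNReal.ofReal c⁻¹ + 4 * c₀ ^ 2 * ((Cn : ℝ≥0∞) * Cn) * K * ρ ≤ (C : ℝ≥0∞) * ρ := by
    have h1 : ENNReal.ofReal c⁻¹ ≤ (Real.toNNReal (3 / c) : ℝ≥0∞) := by
      rw [← ENNReal.ofReal_coe_nnreal, Real.coe_toNNReal _ (by positivity)]
      exact ENNReal.ofReal_le_ofReal (by rw [div_eq_mul_inv]; nlinarith [inv_pos.2 hc])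
    have h2 : 4 * c₀ ^ 2 * ((Cn : ℝ≥0∞) * Cn) * K ≤
        ((4 * 9 ^ n * ((n : ℝ≥0) + 1) ^ 2 * Cn ^ 2 * (K + 1) : ℝ≥0) : ℝ≥0∞) := by
      push_cast
      rw [hc₀]
      have : (K : ℝ≥0∞) ≤ K + 1 := le_self_add
      calc 4 * (3 ^ n * ((n : ℝ≥0∞) + 1)) ^ 2 * ((Cn : ℝ≥0∞) * Cn) * K
          = 4 * 9 ^ n * ((n : ℝ≥0∞) + 1) ^ 2 * (Cn : ℝ≥0∞) ^ 2 * K := by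
            rw [mul_pow, ← pow_mul, show (3 : ℝ≥0∞) ^ (n * 2) = 9 ^ n by
              rw [mul_comm, pow_mul]; norm_num]
            ring
        _ ≤ 4 * 9 ^ n * ((n : ℝ≥0∞) + 1) ^ 2 * (Cn : ℝ≥0∞) ^ 2 * (K + 1) := by gcongr
    calc ENNReal.ofReal c⁻¹ + 4 * c₀ ^ 2 * ((Cn : ℝ≥0∞) * Cn) * K * ρ
        ≤ (Real.toNNReal (3 / c) : ℝ≥0∞) * ρ +
            ((4 * 9 ^ n * ((n : ℝ≥0) + 1) ^ 2 * Cn ^ 2 * (K + 1) : ℝ≥0) : ℝ≥0∞) * ρ :=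
          add_le_add ((h1.trans (le_mul_of_one_le_right' hρ))) (mul_le_mul' h2 le_rfl)
      _ ≤ (C : ℝ≥0∞) * ρ := by
          rw [← add_mul, hC, invConst]
          gcongr
          push_cast
          exact add_le_add le_self_add le_rfl
  have hCH : ENNReal.ofReal c⁻¹ + 2 * c₀ ^ 2 * ((Cn : ℝ≥0∞) * Cn) * (K + 1) * H * ρ ≤
      (C : ℝ≥0∞) * H * ρ := by
    have h1 : ENNReal.ofReal c⁻¹ ≤ (Real.toNNReal (2 * (c ^ 2)⁻¹) : ℝ≥0∞) * H * ρ := by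
      refine hcinv.trans ?_
      rw [← ENNReal.ofReal_coe_nnreal, Real.coe_toNNReal _ (by positivity)]
      calc ENNReal.ofReal (c ^ 2)⁻¹ * H ≤ ENNReal.ofReal (2 * (c ^ 2)⁻¹) * H :=
            mul_le_mul_of_nonneg_right (ENNReal.ofReal_le_ofReal (by nlinarith [inv_pos.2 (pow_pos hc 2)])) bot_le
        _ ≤ ENNReal.ofReal (2 * (c ^ 2)⁻¹) * H * ρ := le_mul_of_one_le_right' hρ
    have h2 : 2 * c₀ ^ 2 * ((Cn : ℝ≥0∞) * Cn) * (K + 1) ≤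
        ((4 * 9 ^ n * ((n : ℝ≥0) + 1) ^ 2 * Cn ^ 2 * (K + 1) : ℝ≥0) : ℝ≥0∞) := by
      push_cast
      rw [hc₀]
      calc 2 * (3 ^ n * ((n : ℝ≥0∞) + 1)) ^ 2 * ((Cn : ℝ≥0∞) * Cn) * (K + 1)
          = 2 * 9 ^ n * ((n : ℝ≥0∞) + 1) ^ 2 * (Cn : ℝ≥0∞) ^ 2 * (K + 1) := by
            rw [mul_pow, ← pow_mul, show (3 : ℝ≥0∞) ^ (n * 2) = 9 ^ n by
              rw [mul_comm, pow_mul]; norm_num]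
            ring
        _ ≤ 4 * 9 ^ n * ((n : ℝ≥0∞) + 1) ^ 2 * (Cn : ℝ≥0∞) ^ 2 * (K + 1) := by
            gcongr; norm_num
    calc ENNReal.ofReal c⁻¹ + 2 * c₀ ^ 2 * ((Cn : ℝ≥0∞) * Cn) * (K + 1) * H * ρ
        ≤ (Real.toNNReal (2 * (c ^ 2)⁻¹) : ℝ≥0∞) * H * ρ +
            ((4 * 9 ^ n * ((n : ℝ≥0) + 1) ^ 2 * Cn ^ 2 * (K + 1) : ℝ≥0) : ℝ≥0∞) * H * ρ :=
          add_le_add h1 (by gcongr)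
      _ ≤ (C : ℝ≥0∞) * H * ρ := by
          rw [← add_mul, ← add_mul, hC, invConst]
          gcongr
          push_cast
          exact add_le_add le_add_self le_rfl
  have hC0 : ENNReal.ofReal (3 / c) ≤ (C : ℝ≥0∞) := by
    rw [hC, invConst]
    exact ENNReal.coe_le_coe.2 (le_self_add.trans le_self_add)
  have hC0' : ENNReal.ofReal (2 * (c ^ 2)⁻¹) ≤ (C : ℝ≥0∞) := by
    rw [hC, invConst]
    exact ENNReal.coe_le_coe.2 (le_add_self.trans le_self_add)
  -- assemble
  refine HolderEnvelope.mk (contDiff_fun_inv hs.contDiff hne) hρ (fun j hj => ?_) (fun j hj => ?_)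
  · rcases j with _ | j
    · rw [pow_zero, mul_one]; exact h00.trans hC0
    · have hjn : j ≤ n := Nat.succ_le_succ_iff.1 hj
      rw [eContDiffHolderNorm_succ_eq_fderiv, hDw]
      calc eSupNorm w + eContDiffHolderNorm j 0 (fun x => q x • _root_.fderiv ℝ s x)
          ≤ ENNReal.ofReal c⁻¹ + 4 * c₀ ^ 2 * ((Cn : ℝ≥0∞) * Cn) * K * ρ * ρ ^ j :=
            add_le_add hsup (hprod.norm_zero_le j hjn)
        _ ≤ (ENNReal.ofReal c⁻¹ + 4 * c₀ ^ 2 * ((Cn : ℝ≥0∞) * Cn) * K * ρ) * ρ ^ j :=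
            add_mul_pow_le hρ j
        _ ≤ (C : ℝ≥0∞) * ρ * ρ ^ j := mul_le_mul' hCA le_rfl
        _ = (C : ℝ≥0∞) * ρ ^ (j + 1) := by rw [pow_succ]; ring
  · rcases j with _ | j
    · rw [pow_zero, mul_one]
      calc eContDiffHolderNorm 0 r (fun y => (s y)⁻¹)
          ≤ ENNReal.ofReal c⁻¹ + ENNReal.ofReal (c ^ 2)⁻¹ * eContDiffHolderNorm 0 r s := h0r
        _ ≤ ENNReal.ofReal (c ^ 2)⁻¹ * H + ENNReal.ofReal (c ^ 2)⁻¹ * H :=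
            add_le_add hcinv (mul_le_mul_of_nonneg_left hs.norm_zero_r_le bot_le)
        _ = ENNReal.ofReal (2 * (c ^ 2)⁻¹) * H := by
            rw [← add_mul, ← ENNReal.ofReal_add (by positivity) (by positivity)]; congr 1; ring
        _ ≤ (C : ℝ≥0∞) * H := mul_le_mul_of_nonneg_right hC0' bot_le
    · have hjn : j ≤ n := Nat.succ_le_succ_iff.1 hj
      rw [eContDiffHolderNorm_succ_eq_fderiv, hDw]
      calc eSupNorm w + eContDiffHolderNorm j r (fun x => q x • _root_.fderiv ℝ s x)
          ≤ ENNReal.ofReal c⁻¹ + 2 * c₀ ^ 2 * ((Cn : ℝ≥0∞) * Cn) * (K + 1) * H * ρ * ρ ^ j :=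
            add_le_add hsup (hprod.norm_le j hjn)
        _ ≤ (ENNReal.ofReal c⁻¹ + 2 * c₀ ^ 2 * ((Cn : ℝ≥0∞) * Cn) * (K + 1) * H * ρ) * ρ ^ j :=
            add_mul_pow_le hρ j
        _ ≤ (C : ℝ≥0∞) * H * ρ * ρ ^ j := mul_le_mul' hCH le_rfl
        _ = (C : ℝ≥0∞) * H * ρ ^ (j + 1) := by rw [pow_succ]; ring

/-- The order-zero case of the reciprocal rule. [folklore] -/
theorem HolderEnvelope.inv_zero {s : E → ℝ} {c : ℝ} (hc : 0 < c) (hcs : ∀ x, c ≤ s x) {n : ℕ}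
    {r : ℝ≥0} {A H ρ : ℝ≥0∞} (hs : HolderEnvelope s n r A H ρ) :
    HolderEnvelope (fun y => (s y)⁻¹) 0 r
      (Real.toNNReal (3 / c) + Real.toNNReal (2 * (c ^ 2)⁻¹) : ℝ≥0)
      ((Real.toNNReal (3 / c) + Real.toNNReal (2 * (c ^ 2)⁻¹) : ℝ≥0) * H) ρ := by
  have hpos : ∀ x, 0 < s x := fun x => hc.trans_le (hcs x)
  have hne : ∀ x, s x ≠ 0 := fun x => (hpos x).ne'
  obtain ⟨h00, h0r⟩ := eContDiffHolderNorm_zero_fun_inv_le hc hcs r (s := s)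
  have hcH : ENNReal.ofReal c ≤ H := by
    obtain ⟨x⟩ := ‹Nonempty E›
    calc ENNReal.ofReal c ≤ ‖s x‖ₑ := by
          rw [← ofReal_norm, Real.norm_eq_abs, abs_of_pos (hpos x)]
          exact ENNReal.ofReal_le_ofReal (hcs x)
      _ ≤ eSupNorm s := enorm_le_eSupNorm s x
      _ ≤ eContDiffHolderNorm 0 r s := eSupNorm_le_eContDiffHolderNorm 0 r s
      _ ≤ H := hs.norm_zero_r_le
  have hcinv : ENNReal.ofReal c⁻¹ ≤ ENNReal.ofReal (c ^ 2)⁻¹ * H := by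
    calc ENNReal.ofReal c⁻¹ = ENNReal.ofReal (c ^ 2)⁻¹ * ENNReal.ofReal c := by
          rw [← ENNReal.ofReal_mul (by positivity)]; congr 1; field_simp
      _ ≤ ENNReal.ofReal (c ^ 2)⁻¹ * H := mul_le_mul_of_nonneg_left hcH bot_le
  refine HolderEnvelope.mk (contDiff_fun_inv hs.contDiff hne) hs.one_le (fun j hj => ?_)
    (fun j hj => ?_)
  · obtain rfl : j = 0 := Nat.le_zero.1 hj
    rw [pow_zero, mul_one]
    refine h00.trans ?_
    push_cast
    exact ENNReal.coe_le_coe.2 le_self_add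
  · obtain rfl : j = 0 := Nat.le_zero.1 hj
    rw [pow_zero, mul_one]
    calc eContDiffHolderNorm 0 r (fun y => (s y)⁻¹)
        ≤ ENNReal.ofReal c⁻¹ + ENNReal.ofReal (c ^ 2)⁻¹ * eContDiffHolderNorm 0 r s := h0r
      _ ≤ ENNReal.ofReal (c ^ 2)⁻¹ * H + ENNReal.ofReal (c ^ 2)⁻¹ * H :=
          add_le_add hcinv (mul_le_mul_of_nonneg_left hs.norm_zero_r_le bot_le)
      _ = ENNReal.ofReal (2 * (c ^ 2)⁻¹) * H := by
          rw [← add_mul, ← ENNReal.ofReal_add (by positivity) (by positivity)]; congr 1; ring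
      _ ≤ _ := by
          refine mul_le_mul_of_nonneg_right ?_ bot_le
          push_cast
          exact ENNReal.coe_le_coe.2 le_add_self

/-- **The reciprocal of a real function bounded below has an envelope** with sup amplitude a
constant and Hölder amplitude linear in that of the function: for every order `n`, lower bound
`c > 0` and sup amplitude bound `K` there is `C = C(n, c, K)` such that `s ≥ c` with envelope
`(K, H, ρ)` to order `n` implies that `1/s` has the envelope `(C, C H, ρ)` to order `n`.
Induction on `n` (`HolderEnvelope.inv_zero`, `HolderEnvelope.inv_step`). [folklore] -/
theorem HolderEnvelope.inv (n : ℕ) {c : ℝ} (hc : 0 < c) (K : ℝ≥0) (r : ℝ≥0) :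
    ∃ C : ℝ≥0, ∀ {s : E → ℝ} {H ρ : ℝ≥0∞}, HolderEnvelope s n r K H ρ → (∀ x, c ≤ s x) →
      HolderEnvelope (fun y => (s y)⁻¹) n r C (C * H) ρ := by
  induction n with
  | zero => exact ⟨_, fun hs hcs => HolderEnvelope.inv_zero hc hcs hs⟩
  | succ n IH =>
    obtain ⟨Cn, hCn⟩ := IH
    refine ⟨invConst c n K Cn, fun {s H ρ} hs hcs => ?_⟩
    exact hs.inv_step hc hcs (hCn (hs.mono (Nat.le_succ n) le_rfl le_rfl) hcs)

end Inv

end Literature.Analysis.FunctionSpaces
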